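import Summits.Ventures.Crystal3D.Theorems.StickyWulffConstantCoaxialWallLawBarlowPlateReadings
import Summits.Ventures.Crystal3D.Theorems.StickyWulffConstantCoaxialWallLawBarlowWindowFrames
import Summits.Ventures.Crystal3D.Theorems.StickyWulffConstantCoaxialWallLawTwoLatticeAdm
import HarnessLib

/-!
# Rigidity at the core of a clamped Barlow plate: a class reading an occupied face at a plate ball IS the root class (F_layer L2c, part 1)

HONEST FRAMING. Venture `Summits/Ventures/Crystal3D` (cell `crystal3d-full`); helper `--supports` the crux `CoaxialWallLaw`
(stmt-Ventures-19481, REGISTERED line `WallLedgerF`) in its role as owner of lane T's debt T-F2 / F_layer (cf-p1 (lxxiii)/(lxxx)/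
(lxxxiii)/(xcix); design memo HOME/wall-19481-p1/g14/L2b-G3.md §5, sink memo HOME/wall-19481-p1/g15/F-LAYER-SINKS-g15.md).
Census-free, standard axioms; nothing about the crux is claimed; F-C1 not moved.

This discharges, for a clamped moved Barlow plate `stacking L s σ` (lane T's presentation), the hypothesis `hstd` of the
plate-abstract end-pair census `word_family_endPairs_plates` / `word_endPairs_multi_plates` (…PayerFamilyEndsPlates /
…PayerEndPairsMultiPlates): «a well-formed class of an in-plane root reading an occupied `60°` face at a core ball moves in the
ROOT DIRECTION».  In fact the class is the ROOT CLASS: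

* `PlateSystem.chain_eq_nil_of_standard` (model) — for a plate system whose frame `G₀` and basal partner `basalMirror ≫ G₀` carry
  the two standard dozens `D₊ = fccSlots`, `D₋ = basalMirror '' fccSlots` (a hypothesis SHAPE, no new definition; instances
  `G₀ = refl` and `G₀ = basalMirror`: `PlateSystem.standardPair_refl` / `PlateSystem.standardPair_basalMirror`), a well-formed chain
  `κ` of a BASAL root whose frame `S.Fw κ` has a standard dozen is EMPTY (19481-p2's `PlateSystem.chain_eq_nil_of_image_eq` +
  `PlateSystem.image_ne_basalMirror`);
* `word_F_eq_fw_trans`, `wfChain_of_wf` — the abstract cell word data `(F, u, WF)` of the census files over the base frame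
  `F [] = G₀ ≫ L` is the model system `⟨G₀, RT⟩` pushed forward by `L`, and its well-formed words are `WFChain`s;
* **`word_eq_nil_of_face_plateBall`** / **`dir_eq_root_of_face_plateBall`** — at a ball `L q + s` of the plate whose radius-2 ball
  lies in the clamped region (configuration `X` ⊇ plate there, `1`-separated), an occupied far `F κ`-face forces `κ = []`, hence
  `F κ (u κ) = F [] (u [])` (pull back by the plate isometry, `plateBall_model_hyps` p690727, 19481-p2's frame lemma
  `frame_of_face_occupied`, then the model statement);
* **`hstd_of_plateCore`** — the hypothesis `hstd` of `word_family_endPairs_plates` VERBATIM for any finite set `P'` of such balls.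
WHAT THIS IS NOT: not the sources (`hPsrc`), not the sealing; F-C1 not moved.
-/

noncomputable section

namespace Summit.Ventures.Crystal3D.Theorems

open Summit.Ventures.Crystal3D Finset
open Literature.MathematicalPhysics.StatisticalMechanics (barlowPos barlowStacking IsHaggSeq barlowPos_mem basalMirror
  basalMirror_basalMirror)
open Summit.Ventures.Crystal3D.Cruxes.TextureLiminf.TexShadow (E3 stacking)
open scoped InnerProductSpace

/-! ### Model: standard classes of a basal-root system are root classes -/

namespace PlateSystem

/-- STANDARD-PAIR frames (hypothesis shape used below, no new definition): the frame `G₀` and its basal partner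
`basalMirror ≫ G₀` carry the two standard dozens `D₊ = fccSlots`, `D₋ = basalMirror '' fccSlots`, in either order.
Instance: the model frame itself. -/
theorem standardPair_refl :
    (((LinearIsometryEquiv.refl ℝ E3 : E3 ≃ₗᵢ[ℝ] E3) : E3 → E3) '' ↑fccSlots = ↑fccSlots ∧
      ((basalMirror.trans (LinearIsometryEquiv.refl ℝ E3) : E3 ≃ₗᵢ[ℝ] E3) : E3 → E3) '' ↑fccSlots =
        (basalMirror : E3 → E3) '' ↑fccSlots) ∨
    (((LinearIsometryEquiv.refl ℝ E3 : E3 ≃ₗᵢ[ℝ] E3) : E3 → E3) '' ↑fccSlots = (basalMirror : E3 → E3) '' ↑fccSlots ∧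
      ((basalMirror.trans (LinearIsometryEquiv.refl ℝ E3) : E3 ≃ₗᵢ[ℝ] E3) : E3 → E3) '' ↑fccSlots = ↑fccSlots) := by
  left
  refine ⟨by simp, ?_⟩
  ext y
  simp

/-- Instance: the basal mirror frame. -/
theorem standardPair_basalMirror :
    (((basalMirror : E3 ≃ₗᵢ[ℝ] E3) : E3 → E3) '' ↑fccSlots = ↑fccSlots ∧
      ((basalMirror.trans basalMirror : E3 ≃ₗᵢ[ℝ] E3) : E3 → E3) '' ↑fccSlots = (basalMirror : E3 → E3) '' ↑fccSlots) ∨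
    (((basalMirror : E3 ≃ₗᵢ[ℝ] E3) : E3 → E3) '' ↑fccSlots = (basalMirror : E3 → E3) '' ↑fccSlots ∧
      ((basalMirror.trans basalMirror : E3 ≃ₗᵢ[ℝ] E3) : E3 → E3) '' ↑fccSlots = ↑fccSlots) := by
  right
  refine ⟨rfl, ?_⟩
  ext y
  simp only [Set.mem_image, LinearIsometryEquiv.coe_trans, Function.comp_apply, basalMirror_basalMirror, mem_coe]
  constructor
  · rintro ⟨x, hx, rfl⟩; exact hx
  · intro hy; exact ⟨y, hy, rfl⟩

/-- **A well-formed chain of a BASAL root whose frame has a standard dozen is the empty chain** (for a standard-pair frame). -/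
theorem chain_eq_nil_of_standard (S : PlateSystem)
    (hG₀ : ((S.G₀ : E3 → E3) '' ↑fccSlots = ↑fccSlots ∧
        ((basalMirror.trans S.G₀ : E3 ≃ₗᵢ[ℝ] E3) : E3 → E3) '' ↑fccSlots = (basalMirror : E3 → E3) '' ↑fccSlots) ∨
      ((S.G₀ : E3 → E3) '' ↑fccSlots = (basalMirror : E3 → E3) '' ↑fccSlots ∧
        ((basalMirror.trans S.G₀ : E3 ≃ₗᵢ[ℝ] E3) : E3 → E3) '' ↑fccSlots = ↑fccSlots))
    {r : E3} (hr2 : r 2 = 0)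
    {κ : List E3} (hκ : WFChain r κ)
    (hstd : (S.Fw κ : E3 → E3) '' ↑fccSlots = ↑fccSlots ∨
      (S.Fw κ : E3 → E3) '' ↑fccSlots = (basalMirror : E3 → E3) '' ↑fccSlots) : κ = [] := by
  have hne := image_ne_basalMirror S hr2 hκ
  -- `(ℝ ∙ e₃)ᗮ.reflection` is `basalMirror` by definition
  change (S.Fw κ : E3 → E3) '' ↑fccSlots ≠ ((basalMirror.trans S.G₀ : E3 ≃ₗᵢ[ℝ] E3) : E3 → E3) '' ↑fccSlots at hne
  rcases hG₀ with ⟨h0, h1⟩ | ⟨h0, h1⟩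
  · rcases hstd with h | h
    · exact chain_eq_nil_of_image_eq S hκ (by rw [h, h0])
    · exact absurd (by rw [h, h1]) hne
  · rcases hstd with h | h
    · exact absurd (by rw [h, h1]) hne
    · exact chain_eq_nil_of_image_eq S hκ (by rw [h, h0])

end PlateSystem

/-! ### Cell: the abstract word data over `F [] = G₀ ≫ L` is the model system pushed forward -/

section WordData

variable {F : List E3 → (E3 ≃ₗᵢ[ℝ] E3)} {u : List E3 → E3} {WF : List E3 → Prop}

/-- The frames of the abstract word data are the model frames pushed forward by the plate isometry `L`. -/
theorem word_F_eq_fw_trans (S : PlateSystem) (L : E3 ≃ₗᵢ[ℝ] E3)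
    (hFc : ∀ μ κ, F (μ :: κ) = ((ℝ ∙ μ)ᗮ.reflection).trans (F κ)) (hF0 : F [] = S.G₀.trans L) :
    ∀ κ, F κ = (S.Fw κ).trans L := by
  intro κ
  induction κ with
  | nil => exact hF0
  | cons μ κ ih => rw [hFc, ih, PlateSystem.fw_cons]; rfl

/-- The root direction alternates: `u κ = (−1)^{|κ|} • u []` (local copy of `word_u_eq_pow`). -/
theorem word_u_eq_pow_root {r : E3} (hu0 : u [] = r) (huc : ∀ μ κ, u (μ :: κ) = -u κ) :
    ∀ κ, u κ = ((-1 : ℝ) ^ κ.length) • r := by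
  intro κ
  induction κ with
  | nil => rw [hu0]; simp
  | cons μ κ ih => rw [huc, ih, List.length_cons, pow_succ]; module

/-- The well-formed words of the abstract word data (root `u [] = r`) are `WFChain r`. -/
theorem wfChain_of_wf {r : E3} (hu0 : u [] = r) (huc : ∀ μ κ, u (μ :: κ) = -u κ)
    (hWFc : ∀ μ κ, WF (μ :: κ) ↔ (WF κ ∧ ‖μ‖ = 1 ∧
      (∀ w ∈ fccSlots, ⟪w, μ⟫_ℝ = 0 ∨ ⟪w, μ⟫_ℝ = Real.sqrt (2 / 3) ∨ ⟪w, μ⟫_ℝ = -Real.sqrt (2 / 3)) ∧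
      ⟪u κ, μ⟫_ℝ = Real.sqrt (2 / 3) ∧ ∀ μ' κ', κ = μ' :: κ' → μ' ≠ -μ)) :
    ∀ κ, WF κ → WFChain r κ := by
  intro κ
  induction κ with
  | nil => intro _; simp only [WFChain]
  | cons μ κ ih =>
    intro hμ
    obtain ⟨hκ, h1, h2, h3, h4⟩ := (hWFc μ κ).1 hμ
    rw [word_u_eq_pow_root hu0 huc κ] at h3
    rw [WFChain]; exact ⟨ih hκ, h1, h2, h3, h4⟩

end WordData

/-! ### Cell: a class reading an occupied face at a clamped plate ball is the root class -/

section Plate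

variable {σ : ℤ → ℤ} (hσ : IsHaggSeq σ) (L : E3 ≃ₗᵢ[ℝ] E3) (s : E3) {X : Finset E3}
  (hsep : ∀ p ∈ X, ∀ p' ∈ X, p ≠ p' → 1 ≤ dist p p') {W : Set E3}
  (hplate : ∀ p ∈ stacking L s σ, p ∈ W → p ∈ X)
  (S : PlateSystem)
  (hG₀ : ((S.G₀ : E3 → E3) '' ↑fccSlots = ↑fccSlots ∧
      ((basalMirror.trans S.G₀ : E3 ≃ₗᵢ[ℝ] E3) : E3 → E3) '' ↑fccSlots = (basalMirror : E3 → E3) '' ↑fccSlots) ∨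
    ((S.G₀ : E3 → E3) '' ↑fccSlots = (basalMirror : E3 → E3) '' ↑fccSlots ∧
      ((basalMirror.trans S.G₀ : E3 ≃ₗᵢ[ℝ] E3) : E3 → E3) '' ↑fccSlots = ↑fccSlots))
  {F : List E3 → (E3 ≃ₗᵢ[ℝ] E3)} {u : List E3 → E3} {WF : List E3 → Prop} {r : E3}
  (hFc : ∀ μ κ, F (μ :: κ) = ((ℝ ∙ μ)ᗮ.reflection).trans (F κ)) (hF0 : F [] = S.G₀.trans L)
  (hr2 : r 2 = 0) (hu0 : u [] = r) (huc : ∀ μ κ, u (μ :: κ) = -u κ)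
  (hWFc : ∀ μ κ, WF (μ :: κ) ↔ (WF κ ∧ ‖μ‖ = 1 ∧
    (∀ w ∈ fccSlots, ⟪w, μ⟫_ℝ = 0 ∨ ⟪w, μ⟫_ℝ = Real.sqrt (2 / 3) ∨ ⟪w, μ⟫_ℝ = -Real.sqrt (2 / 3)) ∧
    ⟪u κ, μ⟫_ℝ = Real.sqrt (2 / 3) ∧ ∀ μ' κ', κ = μ' :: κ' → μ' ≠ -μ))

include hσ hsep hplate hG₀ hFc hF0 hr2 hu0 huc hWFc

open scoped Classical in
/-- **A class reading an occupied `60°` face at a clamped plate ball is the ROOT class.**  The ball is `L q + s`,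
`q = barlowPos … σ k i j`, and its radius-`2` ball lies in the region `W` on which `X` contains the plate. -/
theorem word_eq_nil_of_face_plateBall (k i j : ℤ)
    (hW : ∀ x, dist (L (barlowPos 1 (Real.sqrt (2 / 3)) σ k i j) + s) x ≤ 2 → x ∈ W)
    {κ : List E3} (hκ : WF κ)
    (hface : ∃ a ∈ fccSlots, ∃ a' ∈ fccSlots, ∃ a'' ∈ fccSlots,
      ⟪a, a'⟫_ℝ = 1 / 2 ∧ ⟪a, a''⟫_ℝ = 1 / 2 ∧ ⟪a', a''⟫_ℝ = 1 / 2 ∧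
      L (barlowPos 1 (Real.sqrt (2 / 3)) σ k i j) + s + F κ a ∈ X ∧
      L (barlowPos 1 (Real.sqrt (2 / 3)) σ k i j) + s + F κ a' ∈ X ∧
      L (barlowPos 1 (Real.sqrt (2 / 3)) σ k i j) + s + F κ a'' ∈ X) : κ = [] := by
  set q : E3 := barlowPos 1 (Real.sqrt (2 / 3)) σ k i j with hq
  obtain ⟨-, hXm⟩ := plateBall_model_hyps L s hsep hplate k i j hW
  have hFκ : F κ = (S.Fw κ).trans L := word_F_eq_fw_trans S L hFc hF0 κ
  -- pull an occupied cell slot back to the model configuration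
  have pull : ∀ a : E3, L q + s + F κ a ∈ X → q + S.Fw κ a ∈ X.image fun x => L.symm (x - s) := by
    intro a ha
    refine mem_image.2 ⟨L q + s + F κ a, ha, ?_⟩
    rw [hFκ, LinearIsometryEquiv.trans_apply]
    have : L q + s + L (S.Fw κ a) - s = L (q + S.Fw κ a) := by rw [map_add]; abel
    rw [this, LinearIsometryEquiv.symm_apply_apply]
  obtain ⟨a, ha, a', ha', a'', ha'', i1, i2, i3, h1, h2, h3⟩ := hface
  have hstd := frame_of_face_occupied hσ (barlowPos_mem k i j) hXm (S.Fw κ) ha ha' ha'' i1 i2 i3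
    (pull a h1) (pull a' h2) (pull a'' h3)
  exact PlateSystem.chain_eq_nil_of_standard S hG₀ hr2 (wfChain_of_wf hu0 huc hWFc κ hκ) hstd

open scoped Classical in
/-- **Hence it moves in the root direction**: `F κ (u κ) = F [] (u [])`. -/
theorem dir_eq_root_of_face_plateBall (k i j : ℤ)
    (hW : ∀ x, dist (L (barlowPos 1 (Real.sqrt (2 / 3)) σ k i j) + s) x ≤ 2 → x ∈ W)
    {κ : List E3} (hκ : WF κ)
    (hface : ∃ a ∈ fccSlots, ∃ a' ∈ fccSlots, ∃ a'' ∈ fccSlots,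
      ⟪a, a'⟫_ℝ = 1 / 2 ∧ ⟪a, a''⟫_ℝ = 1 / 2 ∧ ⟪a', a''⟫_ℝ = 1 / 2 ∧
      L (barlowPos 1 (Real.sqrt (2 / 3)) σ k i j) + s + F κ a ∈ X ∧
      L (barlowPos 1 (Real.sqrt (2 / 3)) σ k i j) + s + F κ a' ∈ X ∧
      L (barlowPos 1 (Real.sqrt (2 / 3)) σ k i j) + s + F κ a'' ∈ X) : F κ (u κ) = F [] (u []) := by
  rw [word_eq_nil_of_face_plateBall hσ L s hsep hplate S hG₀ hFc hF0 hr2 hu0 huc hWFc k i j hW hκ hface]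

open scoped Classical in
/-- **The hypothesis `hstd` of `word_family_endPairs_plates` for a clamped Barlow plate core.**  `P'` is any finite set of
plate balls whose radius-`2` balls lie in the clamped region `W`. -/
theorem hstd_of_plateCore (P' : Finset E3)
    (hP' : ∀ p ∈ P', ∃ k i j : ℤ, p = L (barlowPos 1 (Real.sqrt (2 / 3)) σ k i j) + s ∧ ∀ x, dist p x ≤ 2 → x ∈ W) :
    ∀ κ, WF κ → ∀ p ∈ P', (∃ a ∈ fccSlots, ∃ a' ∈ fccSlots, ∃ a'' ∈ fccSlots,
        ⟪a, a'⟫_ℝ = 1 / 2 ∧ ⟪a, a''⟫_ℝ = 1 / 2 ∧ ⟪a', a''⟫_ℝ = 1 / 2 ∧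
        p + F κ a ∈ X ∧ p + F κ a' ∈ X ∧ p + F κ a'' ∈ X) → F κ (u κ) = F [] (u []) := by
  intro κ hκ p hp hface
  obtain ⟨k, i, j, rfl, hW⟩ := hP' p hp
  exact dir_eq_root_of_face_plateBall hσ L s hsep hplate S hG₀ hFc hF0 hr2 hu0 huc hWFc k i j hW hκ hface

end Plate

end Summit.Ventures.Crystal3D.Theorems

end
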